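import Mathlib.Data.Nat.Choose.Central
import Literature.Computability.AlgebraicComplexity.SDPPWreathTPP
import Literature.Computability.AlgebraicComplexity.SDPPCyclicPowerConstruction
import HarnessLib

/-!
# ω-census, family (b2-D) two families / SDPP: CKSU's primary road "Prop. 4.5 + Thm. 4.3 + Cor. 1.9" in the kernel

HONEST FRAMING (pub-omega census; verbatim): lottery ticket; floor = certified bounds/negative ranges.
Census BOOKKEEPING for the Cohn–Umans track, not progress on `ω` (the tree proves `ω < 2.373` by the laser
method). Census row R28 ("(b2) CKSU Prop 24 / Thm 38, `ω < 2.48` at `m = 6`, `2.4784951…`") was kernel through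
the strong-USP route of CKSU §3.3 (`CKSUTriangleOmegaBound.lean`). This file derives the SAME value through the
row's own label: the simultaneous-double-product construction of CKSU Prop. 4.5 / arXiv Prop. 24
(`Literature/…/SDPPCyclicPowerConstruction.lean`, `CohnKleinbergSzegedyUmans2005_prop24`) fed to the
wreath-product theorem CKSU Thm. 4.3 / arXiv Thm. 22 (`Literature/…/SDPPWreathTPP.lean`,
`realizesTPP_of_isSDPP`; printed statement, proof supplied there — CKSU deferred it to an unpublished full
version), then Cor. 1.9 (`CKSU2005_cor19_holds`) with the index bound `d_max ≤ N!` (Serre, Cor. to Thm. 9;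
`SymWreath.maxCharDegree_symWreath_le`), Stirling, and `ℓ → ∞`.

Chain (0 facts): for an SDPP family of `n` pairs with `|Aᵢ||Bᵢ| = a` in an abelian `H`,
`N! · (a^N)^ω ≤ |H|^{3N}` with `N = |Δₙ|` (`sdpp_factorial_mul_rpow_le`) — CKSU's proof of Thm. 4.4
restricted to one family (no tensor powers needed because Prop. 4.5's family is already uniform and
`n → ∞` is built in); for `C^{2ℓ}`, `m = |C| ≥ 3`: `ω ≤ 3 log m/log(m−1) − log(N!)/(2ℓ N log(m−1))`
(`omega_le_of_sdpp_cyclicPower`); with `log N! ≥ N log N − N`, `N ≥ (n/2)²`, `n = binom(2ℓ,ℓ) ≥ 4^ℓ/(2ℓ)`: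
`ω ≤ (3 log m − 2 log 2)/log(m−1) + (2 log(8ℓ) + 1)/(2ℓ log(m−1))` for every `ℓ ≥ 1`
(`omega_le_sdpp_wreath_explicit`), hence `ω ≤ (3 log m − 2 log 2)/log(m−1) + ε` for every `ε > 0`
(`omega_le_cksu_prop24_wreath`, `tendsto_wreath_correction`) — the paper's `(3β−2)/α` with `α = log₂(m−1)`,
`β = log₂ m`; the `ε`-free statement and the `m = 6` value `2.4785` (census R28; "Taking `m = 6` yields exactly the
same bound as in Subsection 3.3 (`ω < 2.48`)") are declared ONCE, in the sibling `CKSUSDPPOmegaBound.lean`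
(Prop. 4.5 + the tree's abelian Thm. 4.4 along CKSU's §6.2 road), whose rows R87–R91 closed form
`(3ℓ log m − log binom(2ℓ,ℓ))/(ℓ log(m−1))` is slightly sharper at finite `ℓ` than this road's single-family bound
(Thm. 4.4's tensor-power step is not repeated here).

## References
* H. Cohn, R. Kleinberg, B. Szegedy, C. Umans, *Group-theoretic algorithms for matrix multiplication*, FOCS 2005;
  arXiv:math/0511460, §4: Prop. 4.5 / 24 and Thm. 4.3 / 22, Thm. 4.4 / 23 (p. 8). [CohnKleinbergSzegedyUmans2005]
-/

noncomputable section

namespace Summit.MatrixMultiplication.OmegaCensus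

open Finset Literature.Computability.AlgebraicComplexity Literature.Computability.AlgebraicComplexity.SDPPWreath
  Literature.Computability.AlgebraicComplexity.SDPPCyclicPower Literature.Computability.AlgebraicComplexity.SymWreath
  Literature.RepresentationTheory.FiniteGroups

/-! ### Step 1: Thm. 4.3 + Cor. 1.9 + `d_max ≤ N!` for a uniform SDPP family -/

/-- Sizes of the hat-triples: `|Â_v||B̂_v||Ĉ_v| = (|A_{v₀}||B_{v₀}|)(|A_{v₁}||B_{v₁}|)(|A_{v₂}||B_{v₂}|)`.
[cite: CohnKleinbergSzegedyUmans2005, Thm. 4.3 (arXiv Thm. 22)] -/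
theorem card_hat_mul {H : Type} [AddCommGroup H] [DecidableEq H] {n : ℕ} (A B : Fin n → Finset H)
    (v : Tri n) :
    (hatA A B v).card * (hatB A B v).card * (hatC A B v).card =
      ((A (v.1 0)).card * (B (v.1 0)).card) * ((A (v.1 1)).card * (B (v.1 1)).card) *
        ((A (v.1 2)).card * (B (v.1 2)).card) := by
  simp only [hatA, hatB, hatC, Finset.card_product, Finset.card_singleton]
  ring

/-- **CKSU's group-theoretic inequality for ONE uniform SDPP family** (the proof of Thm. 4.4 / 23 without
the tensor-power step): if `(Aᵢ, Bᵢ)_{i<n}` is an SDPP family in a finite abelian `H` with `|Aᵢ||Bᵢ| = a`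
for all `i`, then with `N = |Δₙ|`: `N! · (a^N)^ω ≤ |H|^{3N}` — from Thm. 4.3 (`realizesTPP_of_isSDPP`:
`|S₁||S₂||S₃| = (N!)³ a^{3N}`), Cor. 1.9 (`CKSU2005_cor19_holds`) and `d_max(Sym(Δₙ) ⋉ (H³)^{Δₙ}) ≤ N!`.
[cite: CohnKleinbergSzegedyUmans2005, Thm. 4.3 and Thm. 4.4 (proof)] -/
theorem sdpp_factorial_mul_rpow_le {H : Type} [AddCommGroup H] [Fintype H] [DecidableEq H] {n : ℕ}
    {A B : Fin n → Finset H} (hS : IsSDPP A B) (a : ℕ) (ha : ∀ i, (A i).card * (B i).card = a) :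
    ((Fintype.card (Tri n)).factorial : ℝ) * ((a : ℝ) ^ Fintype.card (Tri n)) ^ omega ℂ ≤
      (Fintype.card H : ℝ) ^ (3 * Fintype.card (Tri n)) := by
  set N := Fintype.card (Tri n) with hN
  have h := CKSU2005_cor19_holds.rpow_le_of_maxCharDegree_le (realizesTPP_of_isSDPP hS)
    (maxCharDegree_symWreath_le (H := H × H × H) (n := N))
  rw [card_symWreath, Fintype.card_prod, Fintype.card_prod] at h
  -- the product of the three sizes
  have hsizes : (sdppWreathSet₁ A B).card * (sdppWreathSet₂ A B).card * (sdppWreathSet₃ A B).card =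
      (N.factorial * a ^ N) ^ 3 := by
    rw [sdppWreathSet₁, sdppWreathSet₂, sdppWreathSet₃, card_stppSet, card_stppSet, card_stppSet]
    have hprod : (∏ r : Fin N, (hatA A B ((triEquiv n).symm r)).card) *
        (∏ r : Fin N, (hatB A B ((triEquiv n).symm r)).card) *
        (∏ r : Fin N, (hatC A B ((triEquiv n).symm r)).card) = a ^ (3 * N) := by
      rw [← Finset.prod_mul_distrib, ← Finset.prod_mul_distrib]
      rw [Finset.prod_congr rfl fun r _ => card_hat_mul A B ((triEquiv n).symm r)]
      simp only [ha]
      rw [Finset.prod_const, Finset.card_univ, Fintype.card_fin]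
      ring
    calc (∏ r : Fin N, (hatA A B ((triEquiv n).symm r)).card) * N.factorial *
          ((∏ r : Fin N, (hatB A B ((triEquiv n).symm r)).card) * N.factorial) *
          ((∏ r : Fin N, (hatC A B ((triEquiv n).symm r)).card) * N.factorial)
        = ((∏ r : Fin N, (hatA A B ((triEquiv n).symm r)).card) *
            (∏ r : Fin N, (hatB A B ((triEquiv n).symm r)).card) *
            (∏ r : Fin N, (hatC A B ((triEquiv n).symm r)).card)) * N.factorial ^ 3 := by ring
      _ = (N.factorial * a ^ N) ^ 3 := by rw [hprod]; ring
  rw [hsizes] at h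
  -- real arithmetic
  have hF : (0 : ℝ) < (N.factorial : ℝ) := by exact_mod_cast Nat.factorial_pos N
  have hX : (0 : ℝ) ≤ ((a : ℝ) ^ N) := by positivity
  have hlhs : (((N.factorial * a ^ N) ^ 3 : ℕ) : ℝ) ^ (omega ℂ / 3) =
      (N.factorial : ℝ) ^ (omega ℂ - 1) * ((N.factorial : ℝ) * ((a : ℝ) ^ N) ^ omega ℂ) := by
    rw [Nat.cast_pow, ← Real.rpow_natCast _ 3, ← Real.rpow_mul (by positivity), Nat.cast_ofNat,
      show (3 : ℝ) * (omega ℂ / 3) = omega ℂ by ring, Nat.cast_mul, Nat.cast_pow,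
      Real.mul_rpow hF.le hX, show omega ℂ = (omega ℂ - 1) + 1 by ring, Real.rpow_add hF,
      Real.rpow_one]
    rw [show omega ℂ - 1 + 1 = omega ℂ by ring]
    ring
  have hrhs : (N.factorial : ℝ) ^ (omega ℂ - 2) *
      (((Fintype.card H * (Fintype.card H * Fintype.card H)) ^ N * N.factorial : ℕ) : ℝ) =
      (N.factorial : ℝ) ^ (omega ℂ - 1) * (Fintype.card H : ℝ) ^ (3 * N) := by
    rw [show omega ℂ - 1 = (omega ℂ - 2) + 1 by ring, Real.rpow_add hF, Real.rpow_one]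
    push_cast
    ring
  rw [hlhs, hrhs] at h
  exact le_of_mul_le_mul_left h (Real.rpow_pos_of_pos hF _)

/-! ### Step 2: the family of Prop. 4.5 in `C^{2ℓ}` -/

/-- `Δₙ` is non-empty for `n ≥ 1` (it contains `(n−1, 0, 0)`). [folklore] -/
theorem card_tri_pos {n : ℕ} (hn : 1 ≤ n) : 0 < Fintype.card (Tri n) := by
  refine Fintype.card_pos_iff.mpr ⟨⟨![⟨n - 1, by omega⟩, ⟨0, by omega⟩, ⟨0, by omega⟩], ?_⟩⟩
  simp

/-- `|Δₙ| ≥ (n/2)²`: `(a, b) ↦ (a, b, n−1−a−b)` is injective on `a, b < n/2`. [folklore] -/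
theorem sq_half_le_card_tri (n : ℕ) : (n / 2) ^ 2 ≤ Fintype.card (Tri n) := by
  classical
  let f : Fin (n / 2) × Fin (n / 2) → Tri n := fun p =>
    ⟨![⟨p.1, by omega⟩, ⟨p.2, by omega⟩, ⟨n - 1 - p.1 - p.2, by omega⟩], by
      simp only [Matrix.cons_val_zero, Matrix.cons_val_one, Matrix.cons_val]
      omega⟩
  have hf : Function.Injective f := by
    rintro ⟨a, b⟩ ⟨a', b'⟩ h
    have h0 := congrArg (fun v : Tri n => ((v.1 0 : ℕ), (v.1 1 : ℕ))) h
    simp only [f, Matrix.cons_val_zero, Matrix.cons_val_one, Prod.mk.injEq] at h0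
    exact Prod.ext (Fin.ext h0.1) (Fin.ext h0.2)
  have := Fintype.card_le_of_injective f hf
  simpa [Fintype.card_prod, Fintype.card_fin, pow_two] using this

/-- **R28 by its own label, finite `ℓ`.** For a finite abelian `C` with `m = |C| ≥ 3` and `ℓ ≥ 1`, the SDPP
family of Prop. 4.5 in `C^{2ℓ}` (`n = binom(2ℓ,ℓ)` pairs, `|Aᵢ||Bᵢ| = (m−1)^{2ℓ}`, `|H| = m^{2ℓ}`) gives, through
Thm. 4.3 + Cor. 1.9: `ω ≤ 3 log m/log(m−1) − log(N!)/(2ℓ N log(m−1))`, `N = |Δₙ|`.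
[cite: CohnKleinbergSzegedyUmans2005, Prop. 4.5 and Thm. 4.3/4.4] -/
theorem omega_le_of_sdpp_cyclicPower (C : Type) [AddCommGroup C] [Fintype C] [DecidableEq C]
    (hm : 3 ≤ Fintype.card C) {ℓ : ℕ} (hℓ : 1 ≤ ℓ) :
    omega ℂ ≤ 3 * Real.log (Fintype.card C) / Real.log ((Fintype.card C : ℝ) - 1) -
      Real.log ((Fintype.card (Tri ((2 * ℓ).choose ℓ))).factorial : ℕ) /
        (2 * ℓ * Fintype.card (Tri ((2 * ℓ).choose ℓ)) * Real.log ((Fintype.card C : ℝ) - 1)) := by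
  obtain ⟨A, B, hS, hAB⟩ := CohnKleinbergSzegedyUmans2005_prop24 C ℓ
  have h := sdpp_factorial_mul_rpow_le hS _ hAB
  rw [Fintype.card_fun, Fintype.card_fin] at h
  set N := Fintype.card (Tri ((2 * ℓ).choose ℓ)) with hN
  set m := Fintype.card C with hmdef
  have hNpos : 0 < N := card_tri_pos (Nat.choose_pos (by omega))
  -- casts
  have hm1 : ((m - 1 : ℕ) : ℝ) = (m : ℝ) - 1 := by rw [Nat.cast_sub (by omega), Nat.cast_one]
  have h3 : (3 : ℝ) ≤ m := by exact_mod_cast hm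
  have hL : 0 < Real.log ((m : ℝ) - 1) := Real.log_pos (by linarith)
  have hF : (0 : ℝ) < (N.factorial : ℕ) := by exact_mod_cast Nat.factorial_pos N
  have hNr : (0 : ℝ) < N := by exact_mod_cast hNpos
  have hℓr : (0 : ℝ) < ℓ := by exact_mod_cast hℓ
  have hbase : (0 : ℝ) < ((m : ℝ) - 1) ^ (2 * ℓ) := pow_pos (by linarith) _
  push_cast at h
  rw [hm1] at h
  -- `h : N! · ((m−1)^{2ℓ})^N)^ω ≤ (m^{2ℓ})^{3N}`; take logs
  have hlog := Real.log_le_log (mul_pos hF (Real.rpow_pos_of_pos (pow_pos hbase N) _)) h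
  rw [Real.log_mul hF.ne' (Real.rpow_pos_of_pos (pow_pos hbase N) _).ne', Real.log_rpow (pow_pos hbase N),
    Real.log_pow, Real.log_pow, Real.log_pow, Real.log_pow] at hlog
  -- `hlog : log N! + ω (N (2ℓ log(m−1))) ≤ 3N (2ℓ log m)`
  push_cast at hlog
  have key : omega ℂ * (2 * (ℓ : ℝ) * N * Real.log ((m : ℝ) - 1)) ≤
      3 * (2 * (ℓ : ℝ) * N) * Real.log m - Real.log ((N.factorial : ℕ) : ℝ) := by
    nlinarith [hlog]
  have hden : (0 : ℝ) < 2 * (ℓ : ℝ) * N * Real.log ((m : ℝ) - 1) := by positivity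
  have e : 3 * Real.log m / Real.log ((m : ℝ) - 1) -
      Real.log ((N.factorial : ℕ) : ℝ) / (2 * (ℓ : ℝ) * N * Real.log ((m : ℝ) - 1)) =
      (3 * (2 * (ℓ : ℝ) * N) * Real.log m - Real.log ((N.factorial : ℕ) : ℝ)) /
        (2 * (ℓ : ℝ) * N * Real.log ((m : ℝ) - 1)) := by
    field_simp
  rw [e, le_div_iff₀ hden]
  exact key

/-! ### Step 3: Stirling and the size of `Δₙ` -/

/-- Stirling from below: `s log s ≤ log s! + s` (from `s^s / s! ≤ e^s`). [folklore] -/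
private theorem mul_log_le_log_factorial_add (s : ℕ) :
    (s : ℝ) * Real.log s ≤ Real.log (Nat.factorial s : ℕ) + s := by
  have hf : (0 : ℝ) < (Nat.factorial s : ℕ) := by exact_mod_cast Nat.factorial_pos s
  have h := Real.pow_div_factorial_le_exp (s : ℝ) (Nat.cast_nonneg s) s
  rw [div_le_iff₀ hf] at h
  rcases Nat.eq_zero_or_pos s with hs | hs
  · subst hs; simp
  have hpos : (0 : ℝ) < (s : ℝ) ^ s := by positivity
  have hlog := Real.log_le_log hpos h
  rw [Real.log_pow, Real.log_mul (Real.exp_pos _).ne' hf.ne', Real.log_exp] at hlog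
  linarith

/-- `4ℓ ≤ 4^ℓ`. [folklore] -/
private theorem four_mul_le_four_pow (ℓ : ℕ) : 4 * ℓ ≤ 4 ^ ℓ := by
  induction ℓ with
  | zero => simp
  | succ k ih =>
    have : 1 ≤ 4 ^ k := Nat.one_le_pow _ _ (by norm_num)
    rw [pow_succ]; omega

/-- **`log |Δₙ| ≥ 4ℓ log 2 − 2 log(8ℓ)`** for `n = binom(2ℓ, ℓ)`, `ℓ ≥ 1`: from `|Δₙ| ≥ (n/2)²` and
`4^ℓ ≤ 2ℓ·binom(2ℓ,ℓ)` (Mathlib `Nat.four_pow_le_two_mul_self_mul_centralBinom`), so `n/2 ≥ 4^ℓ/(8ℓ)`.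
[folklore] -/
theorem log_card_tri_ge {ℓ : ℕ} (hℓ : 1 ≤ ℓ) :
    4 * ℓ * Real.log 2 - 2 * Real.log (8 * ℓ) ≤ Real.log (Fintype.card (Tri ((2 * ℓ).choose ℓ)) : ℝ) := by
  set n := (2 * ℓ).choose ℓ with hn
  have h4 : 4 ^ ℓ ≤ 2 * ℓ * n := by
    have := Nat.four_pow_le_two_mul_self_mul_centralBinom ℓ hℓ
    rwa [Nat.centralBinom_eq_two_mul_choose] at this
  have hh : n - 1 ≤ 2 * (n / 2) := by omega
  have hN := sq_half_le_card_tri n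
  have hpow := four_mul_le_four_pow ℓ
  -- reals
  have hℓr : (0 : ℝ) < ℓ := by exact_mod_cast hℓ
  have h4r : (4 : ℝ) ^ ℓ ≤ 2 * ℓ * n := by exact_mod_cast h4
  have hpowr : (4 : ℝ) * ℓ ≤ (4 : ℝ) ^ ℓ := by exact_mod_cast hpow
  have hn1 : (1 : ℝ) ≤ n := by
    have : 1 ≤ n := Nat.choose_pos (by omega)
    exact_mod_cast this
  have hhr : (n : ℝ) - 1 ≤ 2 * ((n / 2 : ℕ) : ℝ) := by
    have : ((n - 1 : ℕ) : ℝ) ≤ ((2 * (n / 2) : ℕ) : ℝ) := by exact_mod_cast hh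
    rwa [Nat.cast_sub (by exact_mod_cast hn1), Nat.cast_one, Nat.cast_mul, Nat.cast_ofNat] at this
  have hNr : (((n / 2 : ℕ) : ℝ)) ^ 2 ≤ (Fintype.card (Tri n) : ℝ) := by exact_mod_cast hN
  -- `h := n/2 ≥ 4^ℓ/(8ℓ)`, i.e. `4^ℓ ≤ 8ℓ·h`
  have hkey : (4 : ℝ) ^ ℓ ≤ 8 * ℓ * ((n / 2 : ℕ) : ℝ) := by nlinarith
  have hhpos : (0 : ℝ) < ((n / 2 : ℕ) : ℝ) := by
    by_contra hle
    have hle := not_lt.mp hle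
    have : (4 : ℝ) ^ ℓ ≤ 0 := by nlinarith
    linarith [pow_pos (by norm_num : (0 : ℝ) < 4) ℓ]
  have hlogh : ℓ * Real.log 4 - Real.log (8 * ℓ) ≤ Real.log ((n / 2 : ℕ) : ℝ) := by
    have := Real.log_le_log (by positivity) hkey
    rw [Real.log_pow, Real.log_mul (by positivity) hhpos.ne'] at this
    linarith
  have hlog4 : Real.log 4 = 2 * Real.log 2 := by
    rw [show (4 : ℝ) = 2 ^ 2 by norm_num, Real.log_pow]; norm_num
  have hfin := Real.log_le_log (by positivity) hNr
  rw [Real.log_pow] at hfin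
  push_cast at hfin
  rw [hlog4] at hlogh
  linarith

/-! ### Step 4: the explicit bound and the limit -/

/-- **R28 by its own label, explicit in `ℓ`:** for `m = |C| ≥ 3` and every `ℓ ≥ 1`,
`ω ≤ (3 log m − 2 log 2)/log(m−1) + (2 log(8ℓ) + 1)/(2ℓ log(m−1))`.
[cite: CohnKleinbergSzegedyUmans2005, Prop. 4.5 and Thm. 4.3/4.4] -/
theorem omega_le_sdpp_wreath_explicit (C : Type) [AddCommGroup C] [Fintype C] [DecidableEq C]
    (hm : 3 ≤ Fintype.card C) {ℓ : ℕ} (hℓ : 1 ≤ ℓ) :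
    omega ℂ ≤ (3 * Real.log (Fintype.card C) - 2 * Real.log 2) / Real.log ((Fintype.card C : ℝ) - 1) +
      (2 * Real.log (8 * ℓ) + 1) / (2 * ℓ * Real.log ((Fintype.card C : ℝ) - 1)) := by
  have h := omega_le_of_sdpp_cyclicPower C hm hℓ
  have hlogN := log_card_tri_ge hℓ
  set N := Fintype.card (Tri ((2 * ℓ).choose ℓ)) with hN
  set m := Fintype.card C with hmdef
  have hNpos : 0 < N := card_tri_pos (Nat.choose_pos (by omega))
  have hNr : (0 : ℝ) < N := by exact_mod_cast hNpos
  have h3 : (3 : ℝ) ≤ m := by exact_mod_cast hm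
  have hL : 0 < Real.log ((m : ℝ) - 1) := Real.log_pos (by linarith)
  have hℓr : (0 : ℝ) < ℓ := by exact_mod_cast hℓ
  have hstir := mul_log_le_log_factorial_add N
  -- `log N! / N ≥ log N − 1 ≥ 4ℓ log 2 − 2 log(8ℓ) − 1`
  have hq : (4 * ℓ * Real.log 2 - 2 * Real.log (8 * ℓ) - 1) / (2 * ℓ * Real.log ((m : ℝ) - 1)) ≤
      Real.log ((N.factorial : ℕ) : ℝ) / (2 * ℓ * N * Real.log ((m : ℝ) - 1)) := by
    rw [div_le_div_iff₀ (by positivity) (by positivity)]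
    have this : (4 * ℓ * Real.log 2 - 2 * Real.log (8 * ℓ) - 1) * N ≤ Real.log ((N.factorial : ℕ) : ℝ) := by
      nlinarith
    have h2 : (0 : ℝ) < 2 * ℓ * Real.log ((m : ℝ) - 1) := by positivity
    calc (4 * ℓ * Real.log 2 - 2 * Real.log (8 * ℓ) - 1) * (2 * ℓ * N * Real.log ((m : ℝ) - 1))
        = (4 * ℓ * Real.log 2 - 2 * Real.log (8 * ℓ) - 1) * N * (2 * ℓ * Real.log ((m : ℝ) - 1)) := by
          ring
      _ ≤ Real.log ((N.factorial : ℕ) : ℝ) * (2 * ℓ * Real.log ((m : ℝ) - 1)) :=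
          mul_le_mul_of_nonneg_right this h2.le
  have e : (3 * Real.log m - 2 * Real.log 2) / Real.log ((m : ℝ) - 1) +
      (2 * Real.log (8 * ℓ) + 1) / (2 * ℓ * Real.log ((m : ℝ) - 1)) =
      3 * Real.log m / Real.log ((m : ℝ) - 1) -
        (4 * ℓ * Real.log 2 - 2 * Real.log (8 * ℓ) - 1) / (2 * ℓ * Real.log ((m : ℝ) - 1)) := by
    field_simp
    ring
  rw [e]
  linarith

open Filter Topology in
/-- The correction term of `omega_le_sdpp_wreath_explicit` tends to `0`: `(2 log(8ℓ) + 1)/(2ℓL) → 0`; with the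
generic limiting step `omega_le_of_forall_le_add` of the sibling `CKSUSDPPOmegaBound.lean` this re-proves that
file's `omega_le_cksu_prop24_limit` (`ω ≤ (3 log m − 2 log 2)/log(m−1)`, at `m = 6`: `2.4785`, census R28) along
the wreath road; the statement is not re-declared here. [folklore] -/
theorem tendsto_wreath_correction (L : ℝ) :
    Tendsto (fun ℓ : ℕ => (2 * Real.log (8 * ℓ) + 1) / (2 * ℓ * L)) atTop (𝓝 0) := by
  rcases eq_or_ne L 0 with hL | hL
  · subst hL; simp
  have h1 : Tendsto (fun x : ℝ => Real.log x ^ 1 / (1 * x + 0)) atTop (𝓝 0) :=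
    Real.tendsto_pow_log_div_mul_add_atTop 1 0 1 one_ne_zero
  have h8 : Tendsto (fun ℓ : ℕ => (8 : ℝ) * ℓ) atTop atTop :=
    tendsto_natCast_atTop_atTop.const_mul_atTop (by norm_num)
  have h2 := (h1.comp h8).const_mul (8 / L)
  have h3 := tendsto_const_div_atTop_nhds_zero_nat (1 / (2 * L) : ℝ)
  have h4 := h2.add h3
  rw [mul_zero, add_zero] at h4
  refine h4.congr' ?_
  filter_upwards [eventually_ge_atTop 1] with ℓ hℓ
  have hℓr : (0 : ℝ) < ℓ := by exact_mod_cast hℓ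
  simp only [Function.comp_def, pow_one, one_mul, add_zero]
  field_simp

open Filter Topology in
/-- **The wreath road reaches the printed `(3β−2)/α`**: for `m = |C| ≥ 3`, `ω ≤ (3 log m − 2 log 2)/log(m−1) + ε`
for every `ε > 0` (from `omega_le_sdpp_wreath_explicit` and `tendsto_wreath_correction`); the `ε`-free statement is
the sibling file's `omega_le_cksu_prop24_limit`. [cite: CohnKleinbergSzegedyUmans2005, Prop. 4.5 and Thm. 4.3/4.4] -/
theorem omega_le_cksu_prop24_wreath (C : Type) [AddCommGroup C] [Fintype C] [DecidableEq C]
    (hm : 3 ≤ Fintype.card C) {ε : ℝ} (hε : 0 < ε) :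
    omega ℂ ≤ (3 * Real.log (Fintype.card C) - 2 * Real.log 2) / Real.log ((Fintype.card C : ℝ) - 1) + ε := by
  have hT := tendsto_wreath_correction (Real.log ((Fintype.card C : ℝ) - 1))
  obtain ⟨ℓ, hℓε, hℓ1⟩ := ((hT.eventually (gt_mem_nhds hε)).and (eventually_ge_atTop 1)).exists
  exact (omega_le_sdpp_wreath_explicit C hm hℓ1).trans (by linarith)

end Summit.MatrixMultiplication.OmegaCensus

end
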